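import Mathlib
import Literature.Computability.AlgebraicComplexity.MatrixMultiplicationExponent
import Literature.Computability.AlgebraicComplexity.FlatteningBound
import HarnessLib

/-!
# Support rank (s-rank) of tensors and the s-rank exponent `ω_s` (Cohn–Umans 2013)

Topic `Literature/Computability/AlgebraicComplexity` (bilinear complexity; relaxations of tensor rank),
over the tree's `tensorRank` / `matMulTensor` / `omega` of `MatrixMultiplicationExponent.lean`
(Bläser 2013 conventions).

Source (held, read 2026-08-15 on the arXiv text): H. Cohn, C. Umans, *Fast matrix multiplication
using coherent configurations*, Proc. SODA 2013, 1074–1087 = arXiv:1207.6528 [CohnUmans2013], §3: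

* Definition 1: "The s-rank `R_s(T)` of a tensor `T` is the minimum rank of a tensor `T′` for which
  `supp(T) = supp(T′)`." — `supportRank`.
* Definition 4: "`ω_s = inf{τ ∈ ℝ : R_s(⟨n,n,n⟩) = O(n^τ)}`." — `sAdmissibleExponents`, `omegaS`
  (rendered exactly like the tree's `admissibleExponents` / `omega`, with `supportRank` in place of
  `tensorRank`).
* Proposition 5: "For all `ℓ, m, n`, we have `(ℓ m n)^{ω_s/3} ≤ R_s(⟨ℓ,m,n⟩)`." — `CohnUmans2013_prop_5`.
* Theorem 6: "The exponents `ω` and `ω_s` satisfy `ω ≤ (3ω_s − 2)/2`." — `CohnUmans2013_thm_6`.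
* The remark before Prop. 5 (p. 5): "every tensor having the same support as `⟨n,n,n⟩` has `n²`
  linearly independent slices, `R_s(⟨n,n,n⟩) ≥ n²`, and thus `2 ≤ ω_s ≤ ω`" — `CohnUmans2013_two_le_omegaS`
  (vendored because `omegaS` is a conditionally complete infimum whose lower bound is needed to use
  Prop. 5 / Thm. 6 without junk).
  DISCHARGED (2026-08-15): `CohnUmans2013_two_le_omegaS_holds`, by the printed slice argument
  (`linearIndependent_of_sameSupport_matMulTensor`, the slice lower bound
  `card_le_tensorRank_of_linearIndependent` of `FlatteningBound.lean`, `sq_le_supportRank_matMulTensor`,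
  `sAdmissibleExponents_two_le`, `omegaS_two_le`, `omegaS_le_omega`), for every field `K`; see the
  section "Discharge" at the end of the file.

The paper works over `ℂ` ("the coefficients `λ_{i,j,k}` are nonzero complex numbers", §2); the
definitions below are stated over any field `K` and the facts over `ℂ`, as printed.

Grounds route MatrixMultiplication/CommutativeSchemes (2026-08-15): item
`Summit.MatrixMultiplication.MatrixMultiplication.Theses.CommutativeSchemes.WeightRemoval`
(stmt-MatrixMultiplication-9463) is "CU13 Prop. 5 + Thm. 6 in finite form" — from a tensor `t` with
the support of `⟨n,n,n⟩` and `tensorRank t ≤ n^{2+ε}` one gets `supportRank (matMulTensor ℂ n n n) ≤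
n^{2+ε}`, Prop. 5 gives `ω_s ≤ 2 + ε` … more precisely `(n³)^{ω_s/3} ≤ n^{2+ε}` i.e. `ω_s ≤ 2 + ε`
for that `n ≥ 2`, and Thm. 6 gives `ω ≤ (3(2+ε) − 2)/2 = 2 + 3ε/2`, exactly the item; and
`…RealizationSRank` (stmt-9466, CU13 Prop. 9) produces the hypothesis. Not in Mathlib/Literature
(`lean search 'sRank|supportRank|omega_s|CohnUmans2013'`: nothing, 2026-08-15).

Nothing is asserted beyond the definitions; users take `(h : CohnUmans2013_prop_5)` etc.

## References
* [CohnUmans2013] H. Cohn, C. Umans, *Fast matrix multiplication using coherent configurations*,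
  SODA 2013 = arXiv:1207.6528, §3: Def. 1, Def. 4, Prop. 5, Thm. 6 (pp. 5–6 of the arXiv text).
* [Blaser2013] M. Bläser, *Fast Matrix Multiplication*, Theory of Computing Library, Graduate
  Surveys 5 (2013), §4–5 (rank, `ω`; the tree's conventions).
-/

noncomputable section

open Filter Asymptotics

namespace Literature.Computability.AlgebraicComplexity

section Defs

variable {K : Type*} [Field K] {ι κ μ : Type*}

/-- Two tensors have the **same support**: the same set of non-zero coordinates
(Cohn–Umans 2013, §3, `supp(T) = supp(T′)`). [cite: CohnUmans2013, Def. 1] -/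
def SameSupport (t t' : ι → κ → μ → K) : Prop :=
  ∀ i j k, t i j k ≠ 0 ↔ t' i j k ≠ 0

/-- **Support rank** (s-rank) `R_s(T)`: the minimum rank of a tensor with the same support as `T`
(Cohn–Umans 2013, Def. 1). An `sInf` over `ℕ` of a non-empty set (`T` itself has the support of
`T`), so no junk value; `supportRank t ≤ tensorRank t`. [cite: CohnUmans2013, Def. 1] -/
def supportRank [Fintype ι] [Fintype κ] [Fintype μ] (t : ι → κ → μ → K) : ℕ :=
  sInf {r : ℕ | ∃ t' : ι → κ → μ → K, SameSupport t t' ∧ tensorRank t' = r}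

variable (K)

/-- The set of **s-admissible exponents** `{τ : R_s(⟨n,n,n⟩) = O(n^τ)}` (Cohn–Umans 2013, Def. 4),
rendered like the tree's `admissibleExponents` with `supportRank` for `tensorRank`.
[cite: CohnUmans2013, Def. 4] -/
def sAdmissibleExponents : Set ℝ :=
  {τ : ℝ | (fun n : ℕ => (supportRank (matMulTensor K n n n) : ℝ)) =O[atTop]
    fun n : ℕ => (n : ℝ) ^ τ}

/-- **The s-rank exponent of matrix multiplication** `ω_s = inf {τ : R_s(⟨n,n,n⟩) = O(n^τ)}`
(Cohn–Umans 2013, Def. 4); a conditionally complete infimum over `ℝ` (the set contains `3` since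
`R_s ≤ R ≤ n³`, and is bounded below by `2` by the slice argument recorded in
`CohnUmans2013_two_le_omegaS`). [cite: CohnUmans2013, Def. 4] -/
def omegaS : ℝ :=
  sInf (sAdmissibleExponents K)

end Defs

/-! ### Elementary API (consequences of the definitions) -/

section API

variable {K : Type*} [Field K] {ι κ μ : Type*}

/-- `SameSupport` is reflexive. [cite: CohnUmans2013, Def. 1] -/
theorem SameSupport.refl (t : ι → κ → μ → K) : SameSupport t t := fun _ _ _ => Iff.rfl

variable [Fintype ι] [Fintype κ] [Fintype μ]

/-- "Clearly s-rank can be no larger than rank" (Cohn–Umans 2013, after Def. 1).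
[cite: CohnUmans2013, §3 (after Def. 1)] -/
theorem supportRank_le_tensorRank (t : ι → κ → μ → K) : supportRank t ≤ tensorRank t :=
  Nat.sInf_le ⟨t, SameSupport.refl t, rfl⟩

/-- A tensor with the same support and rank `≤ r` bounds the s-rank by `r` (Cohn–Umans 2013, Def. 1).
[cite: CohnUmans2013, Def. 1] -/
theorem supportRank_le_of_sameSupport {t t' : ι → κ → μ → K} (h : SameSupport t t') {r : ℕ}
    (hr : tensorRank t' ≤ r) : supportRank t ≤ r := by
  have h1 : supportRank t ≤ tensorRank t' := Nat.sInf_le ⟨t', h, rfl⟩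
  exact h1.trans hr

end API

/-! ### Named facts (nothing asserted) -/

/-- **Cohn–Umans 2013, remark before Prop. 5** (p. 5): "every tensor having the same support as
`⟨n,n,n⟩` has `n²` linearly independent slices, `R_s(⟨n,n,n⟩) ≥ n²`, and thus `2 ≤ ω_s ≤ ω`" — rendered
as the two inequalities on the exponents over `ℂ`. Users take `(h : CohnUmans2013_two_le_omegaS)`.
[cite: CohnUmans2013, §3 (before Prop. 5)] -/
def CohnUmans2013_two_le_omegaS : Prop :=
  2 ≤ omegaS ℂ ∧ omegaS ℂ ≤ omega ℂ

/-- **Cohn–Umans 2013, Proposition 5**: "For all `ℓ, m, n`, we have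
`(ℓ m n)^{ω_s/3} ≤ R_s(⟨ℓ,m,n⟩)`" (over `ℂ`). Users take `(h : CohnUmans2013_prop_5)`.
[cite: CohnUmans2013, Prop. 5] -/
def CohnUmans2013_prop_5 : Prop :=
  ∀ l m n : ℕ, ((l * m * n : ℕ) : ℝ) ^ (omegaS ℂ / 3) ≤ (supportRank (matMulTensor ℂ l m n) : ℝ)

/-- **Cohn–Umans 2013, Theorem 6** (weight removal): "The exponents `ω` and `ω_s` satisfy
`ω ≤ (3ω_s − 2)/2`" (over `ℂ`; proof via triangle-free sets in `Δ_N` and the asymptotic sum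
inequality). Users take `(h : CohnUmans2013_thm_6)`. [cite: CohnUmans2013, Thm. 6] -/
def CohnUmans2013_thm_6 : Prop :=
  omega ℂ ≤ (3 * omegaS ℂ - 2) / 2

/-- How the two facts give the route item `WeightRemoval` (stmt-MatrixMultiplication-9463), as a
sanity derivation fixing the reading of the binders: if `⟨n,n,n⟩` (`n ≥ 2`) has a same-support tensor
of rank `≤ n^{2+ε}` then `ω(ℂ) ≤ 2 + 3ε/2` (for any real `ε`; the item has `ε > 0`).
[cite: CohnUmans2013, Prop. 5, Thm. 6] -/
theorem omega_le_of_sameSupport_rank_le (h5 : CohnUmans2013_prop_5) (h6 : CohnUmans2013_thm_6)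
    {ε : ℝ} {n : ℕ} (hn : 2 ≤ n)
    (h : ∃ t : (Fin n × Fin n) → (Fin n × Fin n) → (Fin n × Fin n) → ℂ,
      SameSupport (matMulTensor ℂ n n n) t ∧ (tensorRank t : ℝ) ≤ (n : ℝ) ^ (2 + ε)) :
    omega ℂ ≤ 2 + 3 / 2 * ε := by
  obtain ⟨t, hst, htr⟩ := h
  have hn0 : (0 : ℝ) < n := by exact_mod_cast (by omega : 0 < n)
  have hn1 : (1 : ℝ) < n := by exact_mod_cast (by omega : 1 < n)
  -- `R_s(⟨n,n,n⟩) ≤ R(t) ≤ n^(2+ε)`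
  have hs : (supportRank (matMulTensor ℂ n n n) : ℝ) ≤ (n : ℝ) ^ (2 + ε) := by
    have h1 : supportRank (matMulTensor ℂ n n n) ≤ tensorRank t :=
      supportRank_le_of_sameSupport hst le_rfl
    exact le_trans (by exact_mod_cast h1) htr
  -- Prop. 5: `(n³)^(ω_s/3) = n^ω_s ≤ R_s(⟨n,n,n⟩)`
  have hp := h5 n n n
  have hpow : ((n * n * n : ℕ) : ℝ) ^ (omegaS ℂ / 3) = (n : ℝ) ^ omegaS ℂ := by
    have : ((n * n * n : ℕ) : ℝ) = (n : ℝ) ^ (3 : ℝ) := by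
      push_cast
      rw [show (3 : ℝ) = ((3 : ℕ) : ℝ) by norm_num, Real.rpow_natCast]
      ring
    rw [this, ← Real.rpow_mul hn0.le]
    congr 1
    ring
  rw [hpow] at hp
  have hle : (n : ℝ) ^ omegaS ℂ ≤ (n : ℝ) ^ (2 + ε) := hp.trans hs
  have hωs : omegaS ℂ ≤ 2 + ε := (Real.rpow_le_rpow_left_iff hn1).1 hle
  -- Thm. 6
  calc omega ℂ ≤ (3 * omegaS ℂ - 2) / 2 := h6
    _ ≤ (3 * (2 + ε) - 2) / 2 := by gcongr
    _ = 2 + 3 / 2 * ε := by ring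

/-! ### Discharge of `CohnUmans2013_two_le_omegaS`: the slice argument, proved

Cohn–Umans 2013, §3, the remark after Def. 4 (before Prop. 5): "Since every tensor having the
same support as `⟨n,n,n⟩` has `n²` linearly independent slices, `R_s(⟨n,n,n⟩) ≥ n²`, and thus
`2 ≤ ω_s ≤ ω`."  The printed argument, step by step, for every field `K`:

1. `linearIndependent_of_sameSupport_matMulTensor` — the slices `a ↦ t(a,·,·)` of a tensor `t`
   with the support of `⟨k,m,n⟩` (`m ≥ 1`) are linearly independent: the slice of `a = (κ,ν)` is
   the only one with a non-zero entry at `((κ,0),(0,ν))` (same computation as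
   `linearIndependent_matMulTensor` of `FlatteningBound.lean`, with "`= 1`" replaced by "`≠ 0`").
2. The slice lower bound `card_le_tensorRank_of_linearIndependent` (`FlatteningBound.lean`,
   Bläser 2013, §7: a decomposition into `r` triads puts every slice in the span of `r` rank-one
   matrices) gives `sq_le_tensorRank_of_sameSupport : n² ≤ R(t)`, hence, the set defining `R_s`
   being non-empty, `sq_le_supportRank_matMulTensor : n² ≤ R_s(⟨n,n,n⟩)`.
3. `sAdmissibleExponents_two_le` — `n² ≤ R_s(⟨n,n,n⟩) = O(n^τ)` forces `τ ≥ 2` (verbatim the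
   argument of `admissibleExponents_two_le`), so `omegaS_two_le : 2 ≤ ω_s(K)` (`le_csInf`, the set
   containing `3`).
4. `R_s ≤ R` termwise (`supportRank_le_tensorRank`) gives
   `admissibleExponents K ⊆ sAdmissibleExponents K`, hence `omegaS_le_omega : ω_s(K) ≤ ω(K)`
   (`csInf_le_csInf`, lower bound from step 3, `admissibleExponents_nonempty`).

`CohnUmans2013_two_le_omegaS_holds` is the case `K = ℂ`. -/

section Discharge

variable (K : Type*) [Field K]

/-- **The slices of a tensor with the support of `⟨k, m, n⟩` are linearly independent** (`m ≥ 1`):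
if `supp(t) = supp(⟨k,m,n⟩)` then the `kn` slices `a ↦ t(a,·,·) ∈ K^{(k×m)×(m×n)}` are linearly
independent, because the slice of `a = (κ, ν)` is the only one with a non-zero entry at
`((κ, 0), (0, ν))` (Cohn–Umans 2013, §3, remark after Def. 4: "every tensor having the same
support as `⟨n,n,n⟩` has `n²` linearly independent slices").
[cite: CohnUmans2013, §3 (remark after Def. 4)] -/
theorem linearIndependent_of_sameSupport_matMulTensor (k m n : ℕ) [NeZero m]
    {t : Fin k × Fin n → Fin k × Fin m → Fin m × Fin n → K}
    (h : SameSupport (matMulTensor K k m n) t) :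
    LinearIndependent K (fun a => t a : Fin k × Fin n → Fin k × Fin m → Fin m × Fin n → K) := by
  rw [Fintype.linearIndependent_iff]
  intro g hg a
  obtain ⟨κ₀, ν₀⟩ := a
  have h0 := congr_fun (congr_fun hg (κ₀, 0)) (0, ν₀)
  rw [Finset.sum_apply, Finset.sum_apply, Fintype.sum_eq_single (κ₀, ν₀)] at h0
  · -- the surviving term: `g (κ₀,ν₀) · t (κ₀,ν₀) (κ₀,0) (0,ν₀) = 0` with a non-zero `t`-entry
    have hne : t (κ₀, ν₀) (κ₀, 0) (0, ν₀) ≠ 0 :=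
      (h (κ₀, ν₀) (κ₀, 0) (0, ν₀)).1 (by simp [matMulTensor])
    rw [Pi.smul_apply, Pi.smul_apply, Pi.zero_apply, Pi.zero_apply, smul_eq_mul] at h0
    exact (mul_eq_zero.1 h0).resolve_right hne
  · -- every other slice vanishes at `((κ₀,0),(0,ν₀))`, by the support condition
    rintro ⟨κ', ν'⟩ hne
    have hmm : matMulTensor K k m n (κ', ν') (κ₀, 0) (0, ν₀) = 0 := by
      simp only [matMulTensor]
      split_ifs with hc
      · exact (hne (by rw [hc.1, hc.2.2])).elim
      · rfl
    have hzero : t (κ', ν') (κ₀, 0) (0, ν₀) = 0 := by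
      by_contra hz
      exact (h (κ', ν') (κ₀, 0) (0, ν₀)).2 hz hmm
    rw [Pi.smul_apply, Pi.smul_apply, smul_eq_mul, hzero, mul_zero]

/-- **`R(t) ≥ n²` for every tensor `t` with the support of `⟨n, n, n⟩`** (Cohn–Umans 2013, §3,
remark after Def. 4): its `n²` slices are linearly independent
(`linearIndependent_of_sameSupport_matMulTensor`) and a tensor with `N` linearly independent
slices has rank `≥ N` (`card_le_tensorRank_of_linearIndependent`, Bläser 2013, §7).
[cite: CohnUmans2013, §3 (remark after Def. 4)] -/
theorem sq_le_tensorRank_of_sameSupport (n : ℕ)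
    {t : Fin n × Fin n → Fin n × Fin n → Fin n × Fin n → K}
    (h : SameSupport (matMulTensor K n n n) t) : n ^ 2 ≤ tensorRank t := by
  rcases Nat.eq_zero_or_pos n with hn | hn
  · subst hn
    simp
  · haveI : NeZero n := ⟨hn.ne'⟩
    simpa [sq] using card_le_tensorRank_of_linearIndependent _
      (linearIndependent_of_sameSupport_matMulTensor K n n n h)

/-- **`R_s(⟨n, n, n⟩) ≥ n²`** (Cohn–Umans 2013, §3, remark after Def. 4: "every tensor having the
same support as `⟨n,n,n⟩` has `n²` linearly independent slices, `R_s(⟨n,n,n⟩) ≥ n²`").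
[cite: CohnUmans2013, §3 (remark after Def. 4)] -/
theorem sq_le_supportRank_matMulTensor (n : ℕ) : n ^ 2 ≤ supportRank (matMulTensor K n n n) := by
  unfold supportRank
  refine le_csInf ⟨_, matMulTensor K n n n, SameSupport.refl _, rfl⟩ ?_
  rintro _ ⟨t, ht, rfl⟩
  exact sq_le_tensorRank_of_sameSupport K n ht

/-- Every s-admissible exponent is `≥ 2`: if `R_s(⟨n,n,n⟩) = O(n^τ)` then, since
`R_s(⟨n,n,n⟩) ≥ n²`, `n^{2-τ}` is bounded, so `τ ≥ 2` (Cohn–Umans 2013, §3, remark after Def. 4: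
"and thus `2 ≤ ω_s`"). [cite: CohnUmans2013, §3 (remark after Def. 4)] -/
theorem sAdmissibleExponents_two_le {τ : ℝ} (hτ : τ ∈ sAdmissibleExponents K) : 2 ≤ τ := by
  by_contra hlt
  rw [not_le] at hlt
  obtain ⟨C, hC⟩ := isBigO_iff.1 hτ
  -- eventually `n ^ (2 - τ) ≤ C`
  have hev : ∀ᶠ n : ℕ in atTop, (n : ℝ) ^ (2 - τ) ≤ C := by
    filter_upwards [hC, eventually_gt_atTop 0] with n hn hn0
    have hn0' : (0 : ℝ) < n := Nat.cast_pos.2 hn0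
    rw [Real.norm_of_nonneg (Nat.cast_nonneg _),
      Real.norm_of_nonneg (Real.rpow_nonneg (Nat.cast_nonneg _) _)] at hn
    have hsq : (n : ℝ) ^ (2 : ℝ) ≤ C * (n : ℝ) ^ τ := by
      refine le_trans ?_ hn
      rw [Real.rpow_two]
      exact_mod_cast sq_le_supportRank_matMulTensor K n
    rw [Real.rpow_sub hn0', div_le_iff₀ (Real.rpow_pos_of_pos hn0' _)]
    exact hsq
  -- but `n ^ (2 - τ) → ∞`
  have hlim : Tendsto (fun n : ℕ => (n : ℝ) ^ (2 - τ)) atTop atTop :=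
    (tendsto_rpow_atTop (by linarith)).comp tendsto_natCast_atTop_atTop
  obtain ⟨n, hn₁, hn₂⟩ := (hev.and (hlim.eventually_gt_atTop C)).exists
  exact absurd hn₁ (not_le.2 hn₂)

/-- The s-admissible exponents are bounded below (by `2`), so `ω_s(K) = inf …` is a genuine
infimum (Cohn–Umans 2013, §3, Def. 4 and the remark after it).
[cite: CohnUmans2013, §3 (remark after Def. 4)] -/
theorem sAdmissibleExponents_bddBelow : BddBelow (sAdmissibleExponents K) :=
  ⟨2, fun _ hτ => sAdmissibleExponents_two_le K hτ⟩

/-- `R_s(⟨n,n,n⟩) = O(R(⟨n,n,n⟩))` (constant `1`): "Clearly s-rank can be no larger than rank"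
(Cohn–Umans 2013, §3, after Def. 1). [cite: CohnUmans2013, §3 (after Def. 1)] -/
theorem isBigO_supportRank_tensorRank_matMulTensor :
    (fun n : ℕ => (supportRank (matMulTensor K n n n) : ℝ)) =O[atTop]
      fun n : ℕ => (tensorRank (matMulTensor K n n n) : ℝ) := by
  refine IsBigO.of_bound 1 (Eventually.of_forall fun n => ?_)
  rw [one_mul, Real.norm_of_nonneg (Nat.cast_nonneg _), Real.norm_of_nonneg (Nat.cast_nonneg _)]
  exact_mod_cast supportRank_le_tensorRank _

/-- Every admissible exponent is s-admissible (`R_s ≤ R`; Cohn–Umans 2013, §3: "upper bounds on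
`ω` imply upper bounds on `ω_s`"). [cite: CohnUmans2013, §3 (after Def. 1 and before Thm. 6)] -/
theorem admissibleExponents_subset_sAdmissibleExponents :
    admissibleExponents K ⊆ sAdmissibleExponents K := fun _ hβ =>
  (isBigO_supportRank_tensorRank_matMulTensor K).trans hβ

/-- `3` is an s-admissible exponent (`R_s(⟨n,n,n⟩) ≤ R(⟨n,n,n⟩) ≤ n³`), so the set defining
`ω_s` is non-empty. [cite: CohnUmans2013, §3 (Def. 4)] -/
theorem three_mem_sAdmissibleExponents : (3 : ℝ) ∈ sAdmissibleExponents K :=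
  admissibleExponents_subset_sAdmissibleExponents K (three_mem_admissibleExponents K)

/-- Non-emptiness of the set of s-admissible exponents. [cite: CohnUmans2013, §3 (Def. 4)] -/
theorem sAdmissibleExponents_nonempty : (sAdmissibleExponents K).Nonempty :=
  ⟨3, three_mem_sAdmissibleExponents K⟩

/-- **`2 ≤ ω_s(K)`** for every field `K` (Cohn–Umans 2013, §3, remark after Def. 4: "and thus
`2 ≤ ω_s ≤ ω`"). [cite: CohnUmans2013, §3 (remark after Def. 4)] -/
theorem omegaS_two_le : 2 ≤ omegaS K :=
  le_csInf (sAdmissibleExponents_nonempty K) fun _ hτ => sAdmissibleExponents_two_le K hτ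

/-- **`ω_s(K) ≤ ω(K)`** for every field `K` (Cohn–Umans 2013, §3, remark after Def. 4: "and thus
`2 ≤ ω_s ≤ ω`"; s-rank is at most rank). [cite: CohnUmans2013, §3 (remark after Def. 4)] -/
theorem omegaS_le_omega : omegaS K ≤ omega K :=
  csInf_le_csInf (sAdmissibleExponents_bddBelow K) (admissibleExponents_nonempty K)
    (admissibleExponents_subset_sAdmissibleExponents K)

/-- `ω_s(K) ≤ 3` (the trivial bound, `3` being s-admissible). [cite: CohnUmans2013, §3 (Def. 4)] -/
theorem omegaS_le_three : omegaS K ≤ 3 :=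
  csInf_le (sAdmissibleExponents_bddBelow K) (three_mem_sAdmissibleExponents K)

/-- **Discharge of `CohnUmans2013_two_le_omegaS`**: `2 ≤ ω_s(ℂ) ≤ ω(ℂ)` (Cohn–Umans 2013, §3,
remark after Def. 4), from `omegaS_two_le` and `omegaS_le_omega` at `K = ℂ`.
[cite: CohnUmans2013, §3 (remark after Def. 4, before Prop. 5)] -/
theorem CohnUmans2013_two_le_omegaS_holds : CohnUmans2013_two_le_omegaS :=
  ⟨omegaS_two_le ℂ, omegaS_le_omega ℂ⟩

end Discharge

end Literature.Computability.AlgebraicComplexity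

end
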